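import Mathlib.Analysis.Complex.ExponentialBounds
import Mathlib.Analysis.SpecialFunctions.Log.Basic

/-!
HONEST FRAMING: exact (Metropolis-corrected) sampling algorithms for lattice gauge theory; figures
of merit are autocorrelation/cost numbers at stated couplings and volumes; no continuum-physics
claim.

# UnitSurvivalPZConstants — THE REAL-ARITHMETIC CONSTANTS OF THE SECOND-MOMENT (PALEY–ZYGMUND) FLOOR: WITH `λ = t(1−t)/K`,
# `κ₁ = t/K`, `K ≥ 8`, `(K+1)ν ≤ 1/20` AND `(1−λ)ⁿK ≥ 32` THE FLOOR OF `Scaling/UnitSurvivalLogFloor` EXCEEDS `1/4`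
# (lean-2 GEN-27, ours; Mathlib-only, no tree parents)

Venture-side (OURS).  Cell `lqcd-flow` (pub-lqcd), unit `pub-lqcd-lean-2-g27`, 2026-08-27/28.  Chapter M, floor side,
file 7a: the constant chase behind `Scaling/UnitSurvivalKLogK` (`OPEN-MATH-chapterM.md` item 2, second-moment part),
kept Mathlib-only so that it builds independently of the chain.  The quantities are those of
`Scaling/UnitSurvivalLogFloor.unitSurvival_secondMoment_floor` (`λ, κ₁, ρ, E_a, C₁, C₂, B, E_q`), here as real
numbers bound by hypotheses-equations.

* `pzConstants_B` — `0 ≤ C₂ ≤ (13/4)t(1−t)`, `0 ≤ B ≤ 7.1λ`.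
* `pzConstants_rho` — `λ/2 ≤ ρ ≤ λ` and `(1−ρ)ⁿ ≤ 3(1−λ)ⁿ` once `(1−λ)ⁿK ≥ 32` (`nλ ≤ log(K/32) ≤ K/32`, so the
  exponent `2nλtκ₁ ≤ t²/16 ≤ 1` and `(1+x)ⁿ ≤ e ≤ 3`).
* `pzConstants_E` — `0 ≤ E_a ≤ 2.2K`, `0 ≤ E_q ≤ 11/20`.
* **`pzConstants_bound`** — the floor `A²/((1−2λ)ⁿK² + BK(1−ρ)ⁿ/((1−ρ)−(1−2λ)) + E_q) − (K+1)ν > 1/4` for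
  `A = (1−λ)ⁿK ≥ 32` (`D ≤ A² + 22A + 2`, `A²/D ≥ 7/20`, `(K+1)ν ≤ 1/20`).

NOT CLAIMED: optimal constants.  Literature grade (cell rule): OWN RESULT (elementary); `Real.add_one_le_exp`,
`Real.exp_one_lt_d9`, `Real.log_le_sub_one_of_pos` from Mathlib; nothing cited as a fact; no new bib keys.
-/

noncomputable section

namespace Summit.Ventures.LatticeQCDFlow.Scaling

/-! ## §1 The constants -/

section Constants

/-- Sizes of `B` and `C₂`: `0 ≤ C₂ ≤ (13/4)t(1−t)`, `0 ≤ B ≤ 7.1λ`. [ours] -/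
theorem pzConstants_B {t K νs lam kap C₁ C₂ B : ℝ} (ht0 : 0 < t) (ht1 : t < 1) (hK : 8 ≤ K) (hνs : 0 ≤ νs)
    (hδ : (K + 1) * νs ≤ 1 / 20) (hlam : lam = t * (1 - t) / K) (hkap : kap = t / K)
    (hC₁ : C₁ = lam * (1 - t) + 2 * t * (1 - t) * νs) (hC₂ : C₂ = t * (1 - t) + 2 * lam * t ^ 2 + 2 * lam * K)
    (hB : B = C₁ + 2 * kap * C₂) :
    0 ≤ C₂ ∧ C₂ ≤ 13 / 4 * (t * (1 - t)) ∧ 0 ≤ B ∧ B ≤ 71 / 10 * lam := by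
  have h1t : 0 < 1 - t := by linarith
  have htt : 0 < t * (1 - t) := mul_pos ht0 h1t
  have hK0 : 0 < K := by linarith
  have hlam0 : 0 < lam := by rw [hlam]; exact div_pos htt hK0
  have hlamK : lam * K = t * (1 - t) := by rw [hlam]; field_simp
  have hkap0 : 0 < kap := by rw [hkap]; exact div_pos ht0 hK0
  have hνK : K * νs ≤ 1 / 20 := by linarith
  have hl8 : 8 * lam ≤ t * (1 - t) := by
    rw [← hlamK]; linarith [mul_le_mul_of_nonneg_left hK hlam0.le]
  have hC₂le : C₂ ≤ 13 / 4 * (t * (1 - t)) := by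
    rw [hC₂]
    have e : 2 * lam * K = 2 * (t * (1 - t)) := by rw [← hlamK]; ring
    have h1 : 2 * lam * t ^ 2 ≤ 2 * lam := by
      have := mul_le_mul_of_nonneg_left (pow_le_one₀ ht0.le ht1.le : t ^ 2 ≤ 1) (by linarith : 0 ≤ 2 * lam)
      linarith
    linarith
  have hC₂0 : 0 ≤ C₂ := by
    rw [hC₂]; exact add_nonneg (add_nonneg htt.le (by positivity)) (mul_nonneg (by linarith) hK0.le)
  have hBle : B ≤ 7 * lam + 2 * t * (1 - t) * νs := by
    rw [hB, hC₁]
    have h1 : 2 * kap * C₂ ≤ 2 * kap * (13 / 4 * (t * (1 - t))) := mul_le_mul_of_nonneg_left hC₂le (by linarith)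
    have h2 : 2 * kap * (13 / 4 * (t * (1 - t))) = 13 / 2 * (lam * t) := by rw [hlam, hkap]; ring
    have h3 : lam * t ≤ lam := mul_le_of_le_one_right hlam0.le ht1.le
    linarith
  have hB0 : 0 ≤ B := by
    rw [hB, hC₁]
    exact add_nonneg (add_nonneg (mul_nonneg hlam0.le h1t.le) (by positivity)) (mul_nonneg (by linarith) hC₂0)
  have hB71 : B ≤ 71 / 10 * lam := by
    have e : 2 * t * (1 - t) * νs = 2 * (lam * (K * νs)) := by rw [hlam]; field_simp
    have := mul_le_mul_of_nonneg_left hνK hlam0.le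
    linarith
  exact ⟨hC₂0, hC₂le, hB0, hB71⟩

/-- Sizes of `ρ` and of the ratio `((1−ρ)/(1−λ))ⁿ`: `λ/2 ≤ ρ ≤ λ` and `(1−ρ)ⁿ ≤ 3(1−λ)ⁿ` once `(1−λ)ⁿK ≥ 32`
(`n·λ ≤ log(K/32) ≤ K/32`, `(1+x)ⁿ ≤ e^{nx} ≤ e`). [ours] -/
theorem pzConstants_rho {t K lam kap rho : ℝ} (ht0 : 0 < t) (ht1 : t < 1) (hK : 8 ≤ K)
    (hlam : lam = t * (1 - t) / K) (hkap : kap = t / K) (hrho : rho = lam - lam * t * kap / (1 - lam))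
    {n : ℕ} (hn : 32 ≤ (1 - lam) ^ n * K) :
    lam / 2 ≤ rho ∧ rho ≤ lam ∧ (1 - rho) ^ n ≤ 3 * (1 - lam) ^ n := by
  have h1t : 0 < 1 - t := by linarith
  have htt : 0 < t * (1 - t) := mul_pos ht0 h1t
  have htt4 : t * (1 - t) ≤ 1 / 4 := by nlinarith [sq_nonneg (t - 1 / 2)]
  have hK0 : 0 < K := by linarith
  have hlam0 : 0 < lam := by rw [hlam]; exact div_pos htt hK0
  have hlam32 : lam ≤ 1 / 32 := by rw [hlam, div_le_iff₀ hK0]; linarith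
  have h1lam : 0 < 1 - lam := by linarith
  have hkap0 : 0 < kap := by rw [hkap]; exact div_pos ht0 hK0
  have hkap1 : kap ≤ 1 / 8 := by rw [hkap, div_le_iff₀ hK0]; linarith
  have htkap : t * kap ≤ kap := mul_le_of_le_one_left hkap0.le ht1.le
  have hsmall : 2 * t * kap ≤ 1 - lam := by linarith
  have hp0 : 0 ≤ lam * t * kap := mul_nonneg (mul_nonneg hlam0.le ht0.le) hkap0.le
  have hx0 : 0 ≤ lam * t * kap / (1 - lam) := div_nonneg hp0 h1lam.le
  have hrho_le : rho ≤ lam := by rw [hrho]; linarith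
  have hrho_ge : lam / 2 ≤ rho := by
    rw [hrho]
    have h1 : lam * t * kap / (1 - lam) ≤ lam / 2 := by
      rw [div_le_iff₀ h1lam]
      have h2 := mul_le_mul_of_nonneg_left hsmall hlam0.le
      have e1 : lam * (2 * t * kap) = 2 * (lam * t * kap) := by ring
      rw [e1] at h2
      linarith
    linarith
  refine ⟨hrho_ge, hrho_le, ?_⟩
  have hratio : 1 - rho ≤ (1 - lam) * (1 + 2 * (lam * t * kap)) := by
    rw [hrho]
    have e : (1 - lam) * (1 + 2 * (lam * t * kap)) = 1 - lam + 2 * (1 - lam) * (lam * t * kap) := by ring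
    rw [e]
    have hq : 1 ≤ 2 * (1 - lam) * (1 - lam) := by linarith [sq_nonneg lam]
    have : lam * t * kap / (1 - lam) ≤ 2 * (1 - lam) * (lam * t * kap) := by
      rw [div_le_iff₀ h1lam]
      have := mul_le_mul_of_nonneg_left hq hp0
      linarith
    linarith
  have hnlam : (n : ℝ) * lam ≤ Real.log (K / 32) := by
    have h1 : Real.log 32 ≤ n * Real.log (1 - lam) + Real.log K := by
      have := Real.log_le_log (by norm_num : (0 : ℝ) < 32) hn
      rw [Real.log_mul (pow_pos h1lam n).ne' hK0.ne', Real.log_pow] at this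
      exact this
    have h2 : Real.log (1 - lam) ≤ -lam := by
      have := Real.log_le_sub_one_of_pos h1lam; linarith
    have h3 := mul_le_mul_of_nonneg_left h2 (Nat.cast_nonneg n)
    rw [Real.log_div hK0.ne' (by norm_num)]
    linarith
  have hlogK : Real.log (K / 32) ≤ K / 32 := by
    have := Real.log_le_sub_one_of_pos (show (0 : ℝ) < K / 32 by positivity); linarith
  have hexp_arg : (n : ℝ) * (2 * (lam * t * kap)) ≤ 1 := by
    have h1 : (n : ℝ) * (2 * (lam * t * kap)) = 2 * (t * kap) * (n * lam) := by ring
    rw [h1]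
    have h2 : 2 * (t * kap) * (n * lam) ≤ 2 * (t * kap) * (K / 32) :=
      mul_le_mul_of_nonneg_left (hnlam.trans hlogK) (by linarith [mul_pos ht0 hkap0])
    have h3 : 2 * (t * kap) * (K / 32) = t * t / 16 := by
      rw [hkap, show 2 * (t * (t / K)) * (K / 32) = t * t / 16 * (K / K) by ring, div_self hK0.ne', mul_one]
    have h4 : t * t ≤ 1 := mul_le_one₀ ht1.le ht0.le ht1.le
    linarith
  have h1 : (1 - rho) ^ n ≤ ((1 - lam) * (1 + 2 * (lam * t * kap))) ^ n :=
    pow_le_pow_left₀ (by linarith) hratio n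
  rw [mul_pow] at h1
  have h2 : (1 + 2 * (lam * t * kap)) ^ n ≤ 3 := by
    have hexp : (1 + 2 * (lam * t * kap)) ^ n ≤ Real.exp (n * (2 * (lam * t * kap))) := by
      rw [Real.exp_nat_mul]
      exact pow_le_pow_left₀ (by linarith) (by have := Real.add_one_le_exp (2 * (lam * t * kap)); linarith) n
    refine hexp.trans ((Real.exp_le_exp.mpr hexp_arg).trans ?_)
    have := Real.exp_one_lt_d9; linarith
  have h3 := mul_le_mul_of_nonneg_left h2 (pow_nonneg h1lam.le n)
  linarith

/-- Sizes of `E_a` and `E_q`: `0 ≤ E_a ≤ 2.2K`, `0 ≤ E_q ≤ 11/20`. [ours] -/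
theorem pzConstants_E {t K νs lam rho Ea C₂ B Eb : ℝ} (ht0 : 0 < t) (ht1 : t < 1) (hK : 8 ≤ K) (hνs : 0 ≤ νs)
    (hδ : (K + 1) * νs ≤ 1 / 20) (hlam : lam = t * (1 - t) / K) (hrho_ge : lam / 2 ≤ rho)
    (hEa : Ea = t * (1 - t) + t * (1 - t) * (1 + lam) / rho) (hC₂0 : 0 ≤ C₂) (hC₂le : C₂ ≤ 13 / 4 * (t * (1 - t)))
    (hB0 : 0 ≤ B) (hB71 : B ≤ 71 / 10 * lam)
    (hEb : Eb = (B * (Ea * νs) + (C₂ * ((1 - t) * νs) + t ^ 2 * (1 - t) * νs)) / (1 - (1 - 2 * lam))) :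
    0 ≤ Ea ∧ Ea ≤ 11 / 5 * K ∧ 0 ≤ Eb ∧ Eb ≤ 11 / 20 := by
  have h1t : 0 < 1 - t := by linarith
  have htt : 0 < t * (1 - t) := mul_pos ht0 h1t
  have htt4 : t * (1 - t) ≤ 1 / 4 := by nlinarith [sq_nonneg (t - 1 / 2)]
  have hK0 : 0 < K := by linarith
  have hlam0 : 0 < lam := by rw [hlam]; exact div_pos htt hK0
  have hlamK : lam * K = t * (1 - t) := by rw [hlam]; field_simp
  have hlam32 : lam ≤ 1 / 32 := by rw [hlam, div_le_iff₀ hK0]; linarith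
  have hrho0 : 0 < rho := by linarith
  have hνK : K * νs ≤ 1 / 20 := by linarith
  have hlamKν : lam * (K * νs) ≤ lam / 20 := by
    have := mul_le_mul_of_nonneg_left hνK hlam0.le; linarith
  have hEa_le : Ea ≤ 11 / 5 * K := by
    rw [hEa]
    have h1 : t * (1 - t) * (1 + lam) / rho ≤ t * (1 - t) * (1 + lam) / (lam / 2) :=
      div_le_div_of_nonneg_left (mul_nonneg htt.le (by linarith)) (by linarith) hrho_ge
    have h2 : t * (1 - t) * (1 + lam) / (lam / 2) = 2 * K * (1 + lam) := by
      rw [← hlamK]; field_simp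
    have h3 : t * (1 - t) ≤ K / 32 := by
      have := mul_le_mul_of_nonneg_right hlam32 hK0.le; linarith
    have h4 : K * lam ≤ K / 32 := by
      have := mul_le_mul_of_nonneg_left hlam32 hK0.le; linarith
    linarith
  have hEa0 : 0 ≤ Ea := by
    rw [hEa]; exact add_nonneg htt.le (div_nonneg (mul_nonneg htt.le (by linarith)) hrho0.le)
  have hnum : 0 ≤ B * (Ea * νs) + (C₂ * ((1 - t) * νs) + t ^ 2 * (1 - t) * νs) :=
    add_nonneg (mul_nonneg hB0 (mul_nonneg hEa0 hνs)) (add_nonneg (mul_nonneg hC₂0 (mul_nonneg h1t.le hνs))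
      (mul_nonneg (mul_nonneg (sq_nonneg t) h1t.le) hνs))
  have hden : (1 : ℝ) - (1 - 2 * lam) = 2 * lam := by ring
  refine ⟨hEa0, hEa_le, ?_, ?_⟩
  · rw [hEb, hden]; exact div_nonneg hnum (by linarith)
  rw [hEb, hden, div_le_iff₀ (by linarith)]
  have hEaν : Ea * νs ≤ 11 / 100 := by
    have := mul_le_mul_of_nonneg_right hEa_le hνs; linarith
  have h1 : B * (Ea * νs) ≤ 71 / 10 * lam * (11 / 100) :=
    mul_le_mul hB71 hEaν (mul_nonneg hEa0 hνs) (by linarith)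
  have h2 : C₂ * ((1 - t) * νs) ≤ 13 / 4 * (t * (1 - t)) * ((1 - t) * νs) :=
    mul_le_mul_of_nonneg_right hC₂le (mul_nonneg h1t.le hνs)
  have h2' : 13 / 4 * (t * (1 - t)) * ((1 - t) * νs) ≤ 13 / 4 * (lam * (K * νs)) := by
    rw [← hlamK]
    have : 0 ≤ t * (lam * K * νs) := by rw [hlamK]; exact mul_nonneg ht0.le (mul_nonneg htt.le hνs)
    linarith
  have h3 : t ^ 2 * (1 - t) * νs ≤ lam * (K * νs) := by
    have e : lam * (K * νs) = t * (1 - t) * νs := by rw [← hlamK]; ring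
    rw [e]
    have ht2 : t ^ 2 ≤ t := by rw [sq]; exact mul_le_of_le_one_left ht0.le ht1.le
    have := mul_le_mul_of_nonneg_right ht2 (mul_nonneg h1t.le hνs)
    linarith
  linarith

/-- **THE CONSTANTS OF THE SECOND-MOMENT FLOOR:** `λ = t(1−t)/K`, `κ₁ = t/K`, `0 < t < 1`, `K ≥ 8`, `ν ≥ 0`,
`(K+1)ν ≤ 1/20`, `A = (1−λ)ⁿK ≥ 32` ⇒ the floor `A²/((1−2λ)ⁿK² + B·K(1−ρ)ⁿ/((1−ρ)−(1−2λ)) + E_q) − (K+1)ν` exceeds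
`1/4`. [ours] -/
theorem pzConstants_bound {t K νs lam kap rho Ea C₁ C₂ B Eb : ℝ} (ht0 : 0 < t) (ht1 : t < 1) (hK : 8 ≤ K) (hνs : 0 ≤ νs)
    (hδ : (K + 1) * νs ≤ 1 / 20) (hlam : lam = t * (1 - t) / K) (hkap : kap = t / K)
    (hrho : rho = lam - lam * t * kap / (1 - lam)) (hEa : Ea = t * (1 - t) + t * (1 - t) * (1 + lam) / rho)
    (hC₁ : C₁ = lam * (1 - t) + 2 * t * (1 - t) * νs) (hC₂ : C₂ = t * (1 - t) + 2 * lam * t ^ 2 + 2 * lam * K)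
    (hB : B = C₁ + 2 * kap * C₂) (hEb : Eb = (B * (Ea * νs) + (C₂ * ((1 - t) * νs) + t ^ 2 * (1 - t) * νs)) / (1 - (1 - 2 * lam)))
    {n : ℕ} (hn : 32 ≤ (1 - lam) ^ n * K) :
    1 / 4 < ((1 - lam) ^ n * K) ^ 2 / ((1 - 2 * lam) ^ n * K ^ 2 + B * K * (1 - rho) ^ n / ((1 - rho) - (1 - 2 * lam)) + Eb)
      - (K + 1) * νs := by
  obtain ⟨hC₂0, hC₂le, hB0, hB71⟩ := pzConstants_B ht0 ht1 hK hνs hδ hlam hkap hC₁ hC₂ hB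
  obtain ⟨hrho_ge, hrho_le, hpow2⟩ := pzConstants_rho ht0 ht1 hK hlam hkap hrho hn
  obtain ⟨hEa0, hEa_le, hEb0, hEb_le⟩ := pzConstants_E ht0 ht1 hK hνs hδ hlam hrho_ge hEa hC₂0 hC₂le hB0 hB71 hEb
  clear hEb hEa hB hC₁ hC₂ hrho
  have h1t : 0 < 1 - t := by linarith
  have htt : 0 < t * (1 - t) := mul_pos ht0 h1t
  have htt4 : t * (1 - t) ≤ 1 / 4 := by nlinarith [sq_nonneg (t - 1 / 2)]
  have hK0 : 0 < K := by linarith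
  have hlam0 : 0 < lam := by rw [hlam]; exact div_pos htt hK0
  have hlam32 : lam ≤ 1 / 32 := by rw [hlam, div_le_iff₀ hK0]; linarith
  have h1lam : 0 < 1 - lam := by linarith
  have hden : (1 - rho) - (1 - 2 * lam) = 2 * lam - rho := by ring
  have hden0 : lam ≤ 2 * lam - rho := by linarith
  set A := (1 - lam) ^ n * K with hA
  have hA32 : 32 ≤ A := hn
  have hA0 : 0 < A := by linarith
  have hpow1 : (1 - 2 * lam) ^ n ≤ ((1 - lam) ^ n) ^ 2 := by
    calc (1 - 2 * lam) ^ n ≤ ((1 - lam) ^ 2) ^ n :=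
          pow_le_pow_left₀ (by linarith) (by linarith [sq_nonneg lam]) n
      _ = ((1 - lam) ^ n) ^ 2 := by rw [← pow_mul, ← pow_mul, mul_comm]
  have hterm1 : (1 - 2 * lam) ^ n * K ^ 2 ≤ A ^ 2 := by
    rw [hA, mul_pow]; exact mul_le_mul_of_nonneg_right hpow1 (by positivity)
  have hterm2 : B * K * (1 - rho) ^ n / ((1 - rho) - (1 - 2 * lam)) ≤ 22 * A + 1 := by
    rw [hden, div_le_iff₀ (by linarith)]
    have h1 : B * K * (1 - rho) ^ n ≤ (71 / 10 * lam) * K * (3 * (1 - lam) ^ n) :=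
      mul_le_mul (mul_le_mul_of_nonneg_right hB71 hK0.le) hpow2 (pow_nonneg (by linarith) n)
        (mul_nonneg (by linarith) hK0.le)
    have h2 : (71 / 10 * lam) * K * (3 * (1 - lam) ^ n) = 213 / 10 * (lam * A) := by rw [hA]; ring
    rw [h2] at h1
    have h3 : 0 ≤ lam * A := mul_nonneg hlam0.le hA0.le
    have h4 := mul_le_mul_of_nonneg_left hden0 (show (0 : ℝ) ≤ 22 * A + 1 by linarith)
    linarith
  have hD : (1 - 2 * lam) ^ n * K ^ 2 + B * K * (1 - rho) ^ n / ((1 - rho) - (1 - 2 * lam)) + Eb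
      ≤ A ^ 2 + 22 * A + 2 := by linarith
  have hDpos : 0 < (1 - 2 * lam) ^ n * K ^ 2 + B * K * (1 - rho) ^ n / ((1 - rho) - (1 - 2 * lam)) + Eb := by
    have : 0 < (1 - 2 * lam) ^ n * K ^ 2 := mul_pos (pow_pos (by linarith) n) (pow_pos hK0 2)
    have : 0 ≤ B * K * (1 - rho) ^ n / ((1 - rho) - (1 - 2 * lam)) := by
      rw [hden]; exact div_nonneg (mul_nonneg (mul_nonneg hB0 hK0.le) (pow_nonneg (by linarith) n)) (by linarith)
    linarith
  have hratio : A ^ 2 / (A ^ 2 + 22 * A + 2) ≤ A ^ 2 / ((1 - 2 * lam) ^ n * K ^ 2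
      + B * K * (1 - rho) ^ n / ((1 - rho) - (1 - 2 * lam)) + Eb) :=
    div_le_div_of_nonneg_left (sq_nonneg A) hDpos hD
  have h7 : 7 / 20 ≤ A ^ 2 / (A ^ 2 + 22 * A + 2) := by
    rw [le_div_iff₀ (by nlinarith [pow_pos hA0 2])]
    have := mul_le_mul_of_nonneg_left hA32 hA0.le
    nlinarith
  rw [hA] at hratio h7
  linarith

end Constants

end Summit.Ventures.LatticeQCDFlow.Scaling

end
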